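import Summits.QuantumFields.YangMills.Theorems.BalabanLadderUVSeamRecResponseVarianceFloor
import Summits.QuantumFields.YangMills.Theorems.BalabanLadderNTMarkovMirror
import Summits.QuantumFields.YangMills.Theorems.BalabanLadderNTBoundaryLawCentred
import Mathlib.Analysis.Convex.Integral
import Mathlib.Analysis.Convex.Mul
import HarnessLib

/-!
# Crux `NT` (stmt-QuantumFields-19353) / seam `UVSeamRec` (stmt-QuantumFields-20043): Jensen in the cube kernels —
# the torus law of the femto RESPONSE VARIABLE `η ↦ kerE_Q^η(F)` is ANTITONE IN THE CUBE in convex order (hypothesis-free)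

Helper file of the fleet lead prover of crux `NT` (unit `ym-spine-19353-p1`, g8); general compact `G`, any lattice
representation `r`, every `β`, every odd torus; no hypothesis of the chain is used.

Both open stubs of the seam price the RESPONSE of a cube kernel to its exterior: 19353's `RefPkgT` clause 1 (E1-osc) is a
`sup_η` law for `kerE_Q^η(dens x)`, 20043's `stub_responseMomentsOdd6` (RM) an exponential-moment law for
`kerE_Q^η(P_q(x))` under the SAMPLED exterior (`η ∼` Wilson's torus measure).  The companion file
`Theorems/BalabanLadderUVSeamRecResponseVarianceFloor` (LEAD 20043 g9) bounds the torus variance of the response from BELOW by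
plain two-point data.  This file is the other, unconditional side: the cube kernels are probability kernels, consistent
under nesting (`BoundaryLaw.kerE_kerE_of_subset`) and versions of the torus conditional expectation
(`StubInherit.integral_lift_eq_integral_kerE_cube`), so CONDITIONAL JENSEN orders the response variables of nested cubes:

* §1 `convex_kerE_le` — Jensen in one kernel: `ψ(kerE_Q^η F) ≤ kerE_Q^η(ψ ∘ F)` for convex continuous `ψ`, bounded measurable
  `F`; `sq_kerE_le` (`ψ = t²`), `exp_abs_kerE_le` (`ψ = exp(λ|t − p|)`, `λ ≥ 0`, the (RM) integrand at one site).
* §2 `convex_kerE_le_kerE_of_subset` — nested cubes `P ⊆ Q`, every exterior: `ψ(kerE_Q^η F) ≤ kerE_Q^η(ζ ↦ ψ(kerE_P^ζ F))`.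
* §3 torus: `torusE_kerE` (the one-cube DLR step as an identity of torus means), `torusE_convex_kerE_le`
  (`E_T[ψ(kerE_Q F)] ≤ E_T[ψ ∘ F]`), **`torusE_convex_kerE_le_of_subset`** (`E_T[ψ(kerE_Q F)] ≤ E_T[ψ(kerE_P F)]` for `P ⊆ Q`
  with one free layer, `Q` fitting the torus): the torus law of the response variable DECREASES IN CONVEX ORDER as the cube
  grows; `torusVar_kerE_le`, `torusVar_kerE_le_of_subset` (variances; the means agree by DLR).
* §4 the letters of (RM) (centre plaquette `P_q(x)`, cubes `(x − (R+1), 2R+3)`): **`torusVar_kerE_plane_antitone`**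
  (`R ↦ Var_T(kerE_R(P_q(x)))` is non-increasing on `1 ≤ R ≤ R' ≤ L − 3`), `torusVar_kerE_plane_le_torusVar_plane`
  (`≤ Var_T(P_q(x))`), `torusE_exp_abs_kerE_plane_antitone` ∕ `torusE_exp_abs_kerE_plane_le_bare` (at a FIXED rate `λ ≥ 0`
  the singleton exponential response moment `E_T[exp(λ|kerE_R(P) − p|)]` is non-increasing in `R` and at most the bare
  moment `E_T[exp(λ|P − p|)]`).

Reading (numbers, not adjectives): with the companion floor, for every `1 ≤ R ≤ R'` and every plaquette `H` one layer off
the `R'`-cube, `Cov_T(H, P)²/Var_T(H) ≤ Var_T(kerE_{R'} P) ≤ Var_T(kerE_R P) ≤ Var_T(P)` — an unconditional monotone bracket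
for the variable the LEAD's kit jobs sample (`V_R(β)`, `R ∈ {1,2,3}`).  (RM) asks MORE than monotonicity: a rate `R⁴` INSIDE
the exponential (`λ = R⁴/C₁` grows with `R`); at fixed `λ` nothing here decays in `R`.
HONEST FRAMING: folklore probability (conditional Jensen ∕ martingale convex ordering; Georgii 2011 Def. 1.23, Rem. 1.24) in
the tree's kernel∕torus vocabulary; nothing of E0′, NT's floors, the seam or the gap; not Clay.
-/

set_option autoImplicit false

noncomputable section

open MeasureTheory Filter Topology
open Literature.MathematicalPhysics.QuantumFieldTheory Literature.MathematicalPhysics.QuantumLattice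
open Literature.Probability.LatticeModels
open Summit.QuantumFields.YangMills.Cruxes.OSLegsFromFemtoAndGap.DlrCollarTransfer
open Summit.QuantumFields.YangMills.Cruxes.OSLegsFromFemtoAndGap.DlrCollarTransfer.StubLower (mem_cubeSites_iff)
open Summit.QuantumFields.YangMills.Cruxes.OSLegsAtWeakCouplingC.InheritedAmplitudeGates.StubInherit
  (integrable_lift integral_lift_eq_integral_kerE_cube)
open Summit.QuantumFields.YangMills.Cruxes.NT.MarkovMirror (isCylinder_kerE kerE_supp_window)
open Summit.QuantumFields.YangMills.Cruxes.NT.BoundaryLaw (kerE_kerE_of_subset cubeSites_subset cubeEdges_subset abs_kerE_le)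
open Summit.QuantumFields.YangMills.Cruxes.NT.Reference (continuous_kerE)
open Summit.QuantumFields.YangMills.Cruxes.UVSeamRec.ResponseVariance (supp_plane_window)

namespace Summit.QuantumFields.YangMills.Cruxes.NT.KernelJensen

/-! ## §0 Scalar facts -/

/-- A continuous function of a bounded observable is bounded. [folklore] -/
theorem exists_abs_comp_le {X : Type*} {F : X → ℝ} {M : ℝ} (hM : ∀ U, |F U| ≤ M) {ψ : ℝ → ℝ}
    (hψ : Continuous ψ) : ∃ C : ℝ, ∀ U, |ψ (F U)| ≤ C := by
  obtain ⟨C, hC⟩ := (isCompact_Icc (a := -M) (b := M)).exists_bound_of_continuousOn hψ.continuousOn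
  exact ⟨C, fun U => by simpa [Real.norm_eq_abs] using hC (F U) (Set.mem_Icc.2 (abs_le.1 (hM U)))⟩

/-- `t ↦ t·t` is convex on `ℝ`. [folklore] -/
theorem convexOn_mul_self : ConvexOn ℝ Set.univ fun t : ℝ => t * t := by
  have h := Even.convexOn_pow (𝕜 := ℝ) even_two
  simpa [pow_two] using h

/-- `t ↦ exp(λ |t − p|)` is convex on `ℝ` for `λ ≥ 0` (the singleton integrand of (RM)). [folklore] -/
theorem convexOn_exp_mul_abs_sub {lam : ℝ} (hlam : 0 ≤ lam) (p : ℝ) :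
    ConvexOn ℝ Set.univ fun t : ℝ => Real.exp (lam * |t - p|) := by
  refine ⟨convex_univ, fun x _ y _ a b ha hb hab => ?_⟩
  have htri : |a • x + b • y - p| ≤ a * |x - p| + b * |y - p| := by
    have hid : a • x + b • y - p = a * (x - p) + b * (y - p) := by
      simp only [smul_eq_mul]
      linear_combination p * hab
    rw [hid]
    calc |a * (x - p) + b * (y - p)| ≤ |a * (x - p)| + |b * (y - p)| := abs_add_le _ _
      _ = a * |x - p| + b * |y - p| := by rw [abs_mul, abs_mul, abs_of_nonneg ha, abs_of_nonneg hb]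
  calc Real.exp (lam * |a • x + b • y - p|)
      ≤ Real.exp (lam * (a * |x - p| + b * |y - p|)) :=
        Real.exp_le_exp.2 (mul_le_mul_of_nonneg_left htri hlam)
    _ = Real.exp (a • (lam * |x - p|) + b • (lam * |y - p|)) := by congr 1; simp only [smul_eq_mul]; ring
    _ ≤ a • Real.exp (lam * |x - p|) + b • Real.exp (lam * |y - p|) :=
        convexOn_exp.2 (Set.mem_univ _) (Set.mem_univ _) ha hb hab

/-- `t ↦ exp(λ|t − p|)` is continuous. [folklore] -/
theorem continuous_exp_mul_abs_sub (lam p : ℝ) : Continuous fun t : ℝ => Real.exp (lam * |t - p|) := by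
  fun_prop

section Kernel

variable (G : Type) [Group G] [TopologicalSpace G] [IsTopologicalGroup G] [CompactSpace G]
  [MeasurableSpace G] [BorelSpace G] (r : LatticeRep G)

/-! ## §1 Jensen in one cube kernel -/

/-- **Jensen in a cube kernel.**  For every cube `Q = (c, b)`, exterior `η`, bounded measurable observable `F` and convex
continuous `ψ : ℝ → ℝ`: `ψ(kerE_Q^η F) ≤ kerE_Q^η(ψ ∘ F)` — the tree's `ymSpecification` kernels are probability measures
(`isProbabilityMeasure_ymSpecification`); Mathlib's `ConvexOn.map_integral_le`. [folklore] -/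
theorem convex_kerE_le (β : ℝ) (c : Fin 4 → ℤ) (b : ℕ) (η : LGConfig 4 G) {F : LGConfig 4 G → ℝ}
    (hF : Measurable F) {M : ℝ} (hM : ∀ U, |F U| ≤ M) {ψ : ℝ → ℝ} (hψ : ConvexOn ℝ Set.univ ψ)
    (hψc : Continuous ψ) :
    ψ (kerE G r β c b η F) ≤ kerE G r β c b η (fun U => ψ (F U)) := by
  haveI := r.secondCountableTopology
  haveI := isProbabilityMeasure_ymSpecification r.ρ r.continuous β (cubeEdges c b) η
  obtain ⟨C, hC⟩ := exists_abs_comp_le hM hψc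
  unfold kerE
  exact hψ.map_integral_le hψc.continuousOn isClosed_univ (ae_of_all _ fun _ => Set.mem_univ _)
    (integrable_of_abs_le hF hM) (integrable_of_abs_le (hψc.measurable.comp hF) hC)

/-- **Second moment**: `(kerE_Q^η F)·(kerE_Q^η F) ≤ kerE_Q^η(F·F)` — the conditional variance is non-negative. [folklore] -/
theorem mul_self_kerE_le (β : ℝ) (c : Fin 4 → ℤ) (b : ℕ) (η : LGConfig 4 G) {F : LGConfig 4 G → ℝ}
    (hF : Measurable F) {M : ℝ} (hM : ∀ U, |F U| ≤ M) :
    kerE G r β c b η F * kerE G r β c b η F ≤ kerE G r β c b η (fun U => F U * F U) :=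
  convex_kerE_le G r β c b η hF hM convexOn_mul_self (continuous_id.mul continuous_id)

/-- **Exponential response moment at one site**: `exp(λ|kerE_Q^η F − p|) ≤ kerE_Q^η(exp(λ|F − p|))` for `λ ≥ 0`. [folklore] -/
theorem exp_abs_kerE_le (β : ℝ) (c : Fin 4 → ℤ) (b : ℕ) (η : LGConfig 4 G) {F : LGConfig 4 G → ℝ}
    (hF : Measurable F) {M : ℝ} (hM : ∀ U, |F U| ≤ M) {lam : ℝ} (hlam : 0 ≤ lam) (p : ℝ) :
    Real.exp (lam * |kerE G r β c b η F - p|) ≤ kerE G r β c b η (fun U => Real.exp (lam * |F U - p|)) :=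
  convex_kerE_le G r β c b η hF hM (convexOn_exp_mul_abs_sub hlam p) (continuous_exp_mul_abs_sub lam p)

/-! ## §2 Nested cubes: DLR consistency + Jensen -/

/-- **Conditional Jensen across nested cubes.**  `P = (c₀, b₀) ⊆ Q = (c, b)` (interior links), ANY exterior `η` of `Q`,
bounded continuous `F`, convex continuous `ψ`: `ψ(kerE_Q^η F) ≤ kerE_Q^η(ζ ↦ ψ(kerE_P^ζ F))` — DLR consistency
`kerE_Q^η F = kerE_Q^η(kerE_P F)` (`BoundaryLaw.kerE_kerE_of_subset`) and Jensen in the `Q`-kernel applied to the bounded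
continuous observable `ζ ↦ kerE_P^ζ F` (Feller property, `Reference.continuous_kerE`). [folklore] -/
theorem convex_kerE_le_kerE_of_subset (β : ℝ) {c c₀ : Fin 4 → ℤ} {b b₀ : ℕ}
    (hsub : cubeEdges c₀ b₀ ⊆ cubeEdges c b) (η : LGConfig 4 G) {F : LGConfig 4 G → ℝ} (hFc : Continuous F)
    {M : ℝ} (hM : ∀ U, |F U| ≤ M) {ψ : ℝ → ℝ} (hψ : ConvexOn ℝ Set.univ ψ) (hψc : Continuous ψ) :
    ψ (kerE G r β c b η F) ≤ kerE G r β c b η (fun ζ => ψ (kerE G r β c₀ b₀ ζ F)) := by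
  haveI := r.secondCountableTopology
  have hk : Continuous fun ζ => kerE G r β c₀ b₀ ζ F := continuous_kerE G r β c₀ b₀ hFc hM
  have hkb : ∀ ζ, |kerE G r β c₀ b₀ ζ F| ≤ M := fun ζ => abs_kerE_le G r β c₀ b₀ ζ hM
  rw [← kerE_kerE_of_subset G r β hsub η hFc.measurable hM]
  exact convex_kerE_le G r β c b η hk.measurable hkb hψ hψc

end Kernel

/-! ## §3 On the torus: the law of the response variable is antitone in the cube (convex order) -/

section Torus

variable (G : Type) [Group G] [TopologicalSpace G] [IsTopologicalGroup G] [CompactSpace G]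
  [MeasurableSpace G] [BorelSpace G] (r : LatticeRep G)

omit [Group G] [TopologicalSpace G] [IsTopologicalGroup G] [CompactSpace G] [MeasurableSpace G] [BorelSpace G] in
/-- A function of a cylinder observable is a cylinder observable with the same support. [folklore] -/
theorem isCylinder_comp {F : LGConfig 4 G → ℝ} {S : Finset (Literature.MathematicalPhysics.QuantumLattice.ZdEdge 4)}
    (hF : IsCylinder F S) (ψ : ℝ → ℝ) : IsCylinder (fun U => ψ (F U)) S :=
  fun _ _ h => congrArg ψ (hF h)

/-- **The one-cube torus DLR step as an identity of torus means**: `E_T[kerE_Q(F)] = E_T[F]` for a cube `Q = (c, b)` with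
`b + 3 ≤ 2L+1` and a bounded continuous cylinder observable `F` whose links are based in the window `[c, c + b]`
(`StubInherit.integral_lift_eq_integral_kerE_cube`). [folklore] -/
theorem torusE_kerE (β : ℝ) (c : Fin 4 → ℤ) (b L : ℕ) (hL : b + 3 ≤ 2 * L + 1)
    {F : LGConfig 4 G → ℝ} (hFc : Continuous F) {M : ℝ} (hM : ∀ U, |F U| ≤ M)
    {S : Finset (Literature.MathematicalPhysics.QuantumLattice.ZdEdge 4)} (hFS : IsCylinder F S)
    (hS : ∀ e ∈ S, ∀ j, c j ≤ e.1 j ∧ e.1 j ≤ c j + b) :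
    torusE G r β L (fun η => kerE G r β c b η F) = torusE G r β L F := by
  unfold torusE
  exact (integral_lift_eq_integral_kerE_cube G r β c b (2 * L + 1) hL hFc hM hFS hS).symm

/-- **One cube: `E_T[ψ(kerE_Q F)] ≤ E_T[ψ ∘ F]`.**  Cube `Q = (c, b)` with `b + 3 ≤ 2L+1`, `F` a bounded continuous cylinder
observable with links in the window `[c, c + b]`, `ψ` convex continuous.  Jensen in the kernel pointwise in the sampled
exterior, then the one-cube torus DLR step for `ψ ∘ F`. [folklore] -/
theorem torusE_convex_kerE_le (β : ℝ) (c : Fin 4 → ℤ) (b L : ℕ) (hL : b + 3 ≤ 2 * L + 1)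
    {F : LGConfig 4 G → ℝ} (hFc : Continuous F) {M : ℝ} (hM : ∀ U, |F U| ≤ M)
    {S : Finset (Literature.MathematicalPhysics.QuantumLattice.ZdEdge 4)} (hFS : IsCylinder F S)
    (hS : ∀ e ∈ S, ∀ j, c j ≤ e.1 j ∧ e.1 j ≤ c j + b) {ψ : ℝ → ℝ} (hψ : ConvexOn ℝ Set.univ ψ)
    (hψc : Continuous ψ) :
    torusE G r β L (fun η => ψ (kerE G r β c b η F)) ≤ torusE G r β L (fun U => ψ (F U)) := by
  haveI := r.secondCountableTopology
  obtain ⟨C, hC⟩ := exists_abs_comp_le hM hψc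
  have hψF : Continuous fun U => ψ (F U) := hψc.comp hFc
  have hk : Continuous fun ζ => kerE G r β c b ζ F := continuous_kerE G r β c b hFc hM
  have hK : Continuous fun ζ => kerE G r β c b ζ (fun U => ψ (F U)) := continuous_kerE G r β c b hψF hC
  have hdlr : torusE G r β L (fun U => ψ (F U)) = torusE G r β L (fun ζ => kerE G r β c b ζ (fun U => ψ (F U))) :=
    (torusE_kerE G r β c b L hL hψF hC (isCylinder_comp G hFS ψ) hS).symm
  have hpt : ∀ ζ : LGConfig 4 G, ψ (kerE G r β c b ζ F) ≤ kerE G r β c b ζ (fun U => ψ (F U)) := fun ζ =>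
    convex_kerE_le G r β c b ζ hFc.measurable hM hψ hψc
  calc torusE G r β L (fun η => ψ (kerE G r β c b η F))
      ≤ torusE G r β L (fun ζ => kerE G r β c b ζ (fun U => ψ (F U))) :=
        integral_mono (integrable_lift G r (T := 2 * L + 1) β (F := fun ζ => ψ (kerE G r β c b ζ F)) (hψc.comp hk))
          (integrable_lift G r (T := 2 * L + 1) β (F := fun ζ => kerE G r β c b ζ (fun U => ψ (F U))) hK)
          fun U => hpt _
    _ = torusE G r β L (fun U => ψ (F U)) := hdlr.symm

/-- **Variance contraction, one cube**: `Var_T(kerE_Q(F)) ≤ Var_T(F)` (same hypotheses): the means agree by DLR and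
`E_T[kerE_Q(F)²] ≤ E_T[F²]`. [folklore] -/
theorem torusVar_kerE_le (β : ℝ) (c : Fin 4 → ℤ) (b L : ℕ) (hL : b + 3 ≤ 2 * L + 1)
    {F : LGConfig 4 G → ℝ} (hFc : Continuous F) {M : ℝ} (hM : ∀ U, |F U| ≤ M)
    {S : Finset (Literature.MathematicalPhysics.QuantumLattice.ZdEdge 4)} (hFS : IsCylinder F S)
    (hS : ∀ e ∈ S, ∀ j, c j ≤ e.1 j ∧ e.1 j ≤ c j + b) :
    torusE G r β L (fun η => kerE G r β c b η F * kerE G r β c b η F) -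
        torusE G r β L (fun η => kerE G r β c b η F) * torusE G r β L (fun η => kerE G r β c b η F) ≤
      torusE G r β L (fun U => F U * F U) - torusE G r β L F * torusE G r β L F := by
  rw [torusE_kerE G r β c b L hL hFc hM hFS hS]
  have h := torusE_convex_kerE_le G r β c b L hL hFc hM hFS hS convexOn_mul_self (continuous_id.mul continuous_id)
  exact sub_le_sub_right h _

/-- The collar window of the sub-cube sits in the window of the cube: if `c j + 1 ≤ c₀ j` and `c₀ j + b₀ ≤ c j + b` then a
link based in `[c₀ − 1, c₀ + b₀]` is based in `[c, c + b]`, and `P = (c₀, b₀) ⊆ Q = (c, b)`. [folklore] -/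
theorem cubeEdges_subset_of_window {c c₀ : Fin 4 → ℤ} {b b₀ : ℕ}
    (hwin : ∀ j, c j + 1 ≤ c₀ j ∧ c₀ j + (b₀ : ℤ) ≤ c j + b) : cubeEdges c₀ b₀ ⊆ cubeEdges c b :=
  cubeEdges_subset (cubeSites_subset fun j => ⟨by linarith [(hwin j).1], (hwin j).2⟩)

/-- **Nested cubes on the torus: the response law is antitone in the cube (convex order).**  Cubes
`P = (c₀, b₀) ⊆ Q = (c, b)` with one free layer below (`c j + 1 ≤ c₀ j`, `c₀ j + b₀ ≤ c j + b`), `Q` fitting the torus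
(`b + 3 ≤ 2L+1`), `F` a bounded continuous cylinder observable with links in `[c₀, c₀ + b₀]`, `ψ` convex continuous:
`E_T[ψ(kerE_Q F)] ≤ E_T[ψ(kerE_P F)]`.  Pointwise `ψ(kerE_Q^η F) ≤ kerE_Q^η(Ψ)` with `Ψ = ψ ∘ kerE_P(F)`
(`convex_kerE_le_kerE_of_subset`), and `Ψ` is a bounded continuous cylinder observable read on the links of `F` and the
collar of `P` (`MarkovMirror.isCylinder_kerE`, window `[c₀ − 1, c₀ + b₀] ⊆ [c, c + b]`), so the torus DLR step for `Q`
turns `E_T[kerE_Q(Ψ)]` into `E_T[Ψ]`. [folklore] -/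
theorem torusE_convex_kerE_le_of_subset (β : ℝ) {c c₀ : Fin 4 → ℤ} {b b₀ : ℕ} (L : ℕ) (hL : b + 3 ≤ 2 * L + 1)
    (hwin : ∀ j, c j + 1 ≤ c₀ j ∧ c₀ j + (b₀ : ℤ) ≤ c j + b)
    {F : LGConfig 4 G → ℝ} (hFc : Continuous F) {M : ℝ} (hM : ∀ U, |F U| ≤ M)
    {S : Finset (Literature.MathematicalPhysics.QuantumLattice.ZdEdge 4)} (hFS : IsCylinder F S)
    (hS : ∀ e ∈ S, ∀ j, c₀ j ≤ e.1 j ∧ e.1 j ≤ c₀ j + b₀) {ψ : ℝ → ℝ} (hψ : ConvexOn ℝ Set.univ ψ)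
    (hψc : Continuous ψ) :
    torusE G r β L (fun η => ψ (kerE G r β c b η F)) ≤ torusE G r β L (fun ζ => ψ (kerE G r β c₀ b₀ ζ F)) := by
  classical
  haveI := r.secondCountableTopology
  have hsub : cubeEdges c₀ b₀ ⊆ cubeEdges c b := cubeEdges_subset_of_window hwin
  have hk : Continuous fun ζ => kerE G r β c₀ b₀ ζ F := continuous_kerE G r β c₀ b₀ hFc hM
  have hkb : ∀ ζ, |kerE G r β c₀ b₀ ζ F| ≤ M := fun ζ => abs_kerE_le G r β c₀ b₀ ζ hM
  have hΨc : Continuous fun ζ => ψ (kerE G r β c₀ b₀ ζ F) := hψc.comp hk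
  obtain ⟨C, hC⟩ := exists_abs_comp_le hkb hψc
  have hΨS := isCylinder_comp G (isCylinder_kerE G r β c₀ b₀ hFc.measurable hFS) ψ
  have hΨwin : ∀ e ∈ S ∪ (plaquettesTouching (cubeEdges c₀ b₀)).biUnion plaquetteEdges, ∀ j,
      c j ≤ e.1 j ∧ e.1 j ≤ c j + b := by
    intro e he j
    have h := kerE_supp_window hS he j
    constructor <;> linarith [h.1, h.2, (hwin j).1, (hwin j).2]
  have hKc : Continuous fun η => kerE G r β c b η F := continuous_kerE G r β c b hFc hM
  have hKΨ : Continuous fun η => kerE G r β c b η (fun ζ => ψ (kerE G r β c₀ b₀ ζ F)) :=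
    continuous_kerE G r β c b hΨc hC
  have hdlr : torusE G r β L (fun ζ => ψ (kerE G r β c₀ b₀ ζ F)) =
      torusE G r β L (fun η => kerE G r β c b η (fun ζ => ψ (kerE G r β c₀ b₀ ζ F))) :=
    (torusE_kerE G r β c b L hL hΨc hC hΨS hΨwin).symm
  have hpt : ∀ η : LGConfig 4 G,
      ψ (kerE G r β c b η F) ≤ kerE G r β c b η (fun ζ => ψ (kerE G r β c₀ b₀ ζ F)) := fun η =>
    convex_kerE_le_kerE_of_subset G r β hsub η hFc hM hψ hψc
  calc torusE G r β L (fun η => ψ (kerE G r β c b η F))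
      ≤ torusE G r β L (fun η => kerE G r β c b η (fun ζ => ψ (kerE G r β c₀ b₀ ζ F))) :=
        integral_mono (integrable_lift G r (T := 2 * L + 1) β (F := fun η => ψ (kerE G r β c b η F)) (hψc.comp hKc))
          (integrable_lift G r (T := 2 * L + 1) β
            (F := fun η => kerE G r β c b η (fun ζ => ψ (kerE G r β c₀ b₀ ζ F))) hKΨ)
          fun U => hpt _
    _ = torusE G r β L (fun ζ => ψ (kerE G r β c₀ b₀ ζ F)) := hdlr.symm

/-- **Variance contraction across nested cubes**: in the setting of `torusE_convex_kerE_le_of_subset`,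
`Var_T(kerE_Q(F)) ≤ Var_T(kerE_P(F))` (both means equal `E_T[F]` by DLR). [folklore] -/
theorem torusVar_kerE_le_of_subset (β : ℝ) {c c₀ : Fin 4 → ℤ} {b b₀ : ℕ} (L : ℕ) (hL : b + 3 ≤ 2 * L + 1)
    (hwin : ∀ j, c j + 1 ≤ c₀ j ∧ c₀ j + (b₀ : ℤ) ≤ c j + b)
    {F : LGConfig 4 G → ℝ} (hFc : Continuous F) {M : ℝ} (hM : ∀ U, |F U| ≤ M)
    {S : Finset (Literature.MathematicalPhysics.QuantumLattice.ZdEdge 4)} (hFS : IsCylinder F S)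
    (hS : ∀ e ∈ S, ∀ j, c₀ j ≤ e.1 j ∧ e.1 j ≤ c₀ j + b₀) :
    torusE G r β L (fun η => kerE G r β c b η F * kerE G r β c b η F) -
        torusE G r β L (fun η => kerE G r β c b η F) * torusE G r β L (fun η => kerE G r β c b η F) ≤
      torusE G r β L (fun ζ => kerE G r β c₀ b₀ ζ F * kerE G r β c₀ b₀ ζ F) -
        torusE G r β L (fun ζ => kerE G r β c₀ b₀ ζ F) * torusE G r β L (fun ζ => kerE G r β c₀ b₀ ζ F) := by
  have hL₀ : b₀ + 3 ≤ 2 * L + 1 := by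
    have h0 := hwin 0
    have : (b₀ : ℤ) + 1 ≤ b := by linarith [h0.1, h0.2]
    omega
  have hSQ : ∀ e ∈ S, ∀ j, c j ≤ e.1 j ∧ e.1 j ≤ c j + b := fun e he j => by
    have h := hS e he j
    constructor <;> linarith [h.1, h.2, (hwin j).1, (hwin j).2]
  rw [torusE_kerE G r β c b L hL hFc hM hFS hSQ, torusE_kerE G r β c₀ b₀ L hL₀ hFc hM hFS hS]
  exact sub_le_sub_right (torusE_convex_kerE_le_of_subset G r β L hL hwin hFc hM hFS hS convexOn_mul_self
    (continuous_id.mul continuous_id)) _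

end Torus

/-! ## §4 In the letters of (RM): the centre plaquette `P_q(x)` and the cubes `(x − (R+1), 2R+3)` -/

section Letters

variable (G : Type) [Group G] [TopologicalSpace G] [IsTopologicalGroup G] [CompactSpace G]
  [MeasurableSpace G] [BorelSpace G] (r : LatticeRep G)

/-- Radius cubes are nested with one free layer: for `R + 1 ≤ R'` the cube `(x − (R+1), 2R+3)` and its collar sit in the
window of `(x − (R'+1), 2R'+3)`. [folklore] -/
theorem radius_window {R R' : ℕ} (hRR' : R + 1 ≤ R') (x : Fin 4 → ℤ) :
    ∀ j, (fun k => x k - ((R' : ℤ) + 1)) j + 1 ≤ (fun k => x k - ((R : ℤ) + 1)) j ∧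
      (fun k => x k - ((R : ℤ) + 1)) j + ((2 * R + 3 : ℕ) : ℤ) ≤ (fun k => x k - ((R' : ℤ) + 1)) j + (2 * R' + 3 : ℕ) := by
  intro j
  have h : (R : ℤ) + 1 ≤ R' := by exact_mod_cast hRR'
  dsimp only
  push_cast
  constructor <;> linarith

/-- **The response law of the centre plaquette is antitone in the radius (convex order).**  For `1 ≤ R`, `R + 1 ≤ R'`,
`R' + 3 ≤ L`, every orientation `q`, site `x`, and convex continuous `ψ`:
`E_T[ψ(kerE_{R'}(P_q(x)))] ≤ E_T[ψ(kerE_R(P_q(x)))]` on the odd torus of side `2L+1` (cube of radius `R` = `(x − (R+1), 2R+3)`,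
the letters of `stub_responseMomentsOdd6`). [folklore] -/
theorem torusE_convex_kerE_plane_antitone (β : ℝ) (L : ℕ) {R R' : ℕ} (hRR' : R + 1 ≤ R') (hL : R' + 3 ≤ L)
    (q : Fin 4 × Fin 4) (x : Fin 4 → ℤ) {ψ : ℝ → ℝ} (hψ : ConvexOn ℝ Set.univ ψ) (hψc : Continuous ψ) :
    torusE G r β L (fun η => ψ (kerE G r β (fun k => x k - ((R' : ℤ) + 1)) (2 * R' + 3) η (plane G r q x))) ≤
      torusE G r β L (fun η => ψ (kerE G r β (fun k => x k - ((R : ℤ) + 1)) (2 * R + 3) η (plane G r q x))) := by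
  obtain ⟨C, hC⟩ := exists_abs_plane_le (G := G) r
  have hT : 2 * R' + 3 + 3 ≤ 2 * L + 1 := by omega
  exact torusE_convex_kerE_le_of_subset G r β L hT (radius_window hRR' x) (continuous_plane r q x) (hC q x)
    (isCylinder_plane r q x) (supp_plane_window R q x) hψ hψc

/-- **`R ↦ Var_T(kerE_R(P_q(x)))` is non-increasing** on `R ≤ R' ≤ L − 3` (odd torus of side `2L+1`): the torus variance
of the femto kernel's response — the variable `V_R(β)` of the LEAD's Monte-Carlo programme and the second moment behind
(RM)'s singleton clause — can only DECREASE as the cube grows.  Hypothesis-free. [folklore] -/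
theorem torusVar_kerE_plane_antitone (β : ℝ) (L : ℕ) {R R' : ℕ} (hRR' : R ≤ R') (hL : R' + 3 ≤ L)
    (q : Fin 4 × Fin 4) (x : Fin 4 → ℤ) :
    torusE G r β L (fun η => kerE G r β (fun k => x k - ((R' : ℤ) + 1)) (2 * R' + 3) η (plane G r q x) *
          kerE G r β (fun k => x k - ((R' : ℤ) + 1)) (2 * R' + 3) η (plane G r q x)) -
        torusE G r β L (fun η => kerE G r β (fun k => x k - ((R' : ℤ) + 1)) (2 * R' + 3) η (plane G r q x)) *
          torusE G r β L (fun η => kerE G r β (fun k => x k - ((R' : ℤ) + 1)) (2 * R' + 3) η (plane G r q x)) ≤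
      torusE G r β L (fun η => kerE G r β (fun k => x k - ((R : ℤ) + 1)) (2 * R + 3) η (plane G r q x) *
          kerE G r β (fun k => x k - ((R : ℤ) + 1)) (2 * R + 3) η (plane G r q x)) -
        torusE G r β L (fun η => kerE G r β (fun k => x k - ((R : ℤ) + 1)) (2 * R + 3) η (plane G r q x)) *
          torusE G r β L (fun η => kerE G r β (fun k => x k - ((R : ℤ) + 1)) (2 * R + 3) η (plane G r q x)) := by
  rcases Nat.eq_or_lt_of_le hRR' with h | h
  · subst h; exact le_rfl
  · obtain ⟨C, hC⟩ := exists_abs_plane_le (G := G) r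
    have hT : 2 * R' + 3 + 3 ≤ 2 * L + 1 := by omega
    exact torusVar_kerE_le_of_subset G r β L hT (radius_window (by omega) x) (continuous_plane r q x) (hC q x)
      (isCylinder_plane r q x) (supp_plane_window R q x)

/-- **The response variance is at most the bare variance**: `Var_T(kerE_R(P_q(x))) ≤ Var_T(P_q(x))` for `R + 3 ≤ L`.
With the companion floor `Cov_T(H, P)² ≤ Var_T(kerE_R(P))·Var_T(H)` (`ResponseVariance.sq_torusCov_le_torusVar_kerE_mul`)
this brackets `V_R(β)` between plain two-point data and the bare plaquette variance, unconditionally. [folklore] -/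
theorem torusVar_kerE_plane_le_torusVar_plane (β : ℝ) (L R : ℕ) (hL : R + 3 ≤ L) (q : Fin 4 × Fin 4) (x : Fin 4 → ℤ) :
    torusE G r β L (fun η => kerE G r β (fun k => x k - ((R : ℤ) + 1)) (2 * R + 3) η (plane G r q x) *
          kerE G r β (fun k => x k - ((R : ℤ) + 1)) (2 * R + 3) η (plane G r q x)) -
        torusE G r β L (fun η => kerE G r β (fun k => x k - ((R : ℤ) + 1)) (2 * R + 3) η (plane G r q x)) *
          torusE G r β L (fun η => kerE G r β (fun k => x k - ((R : ℤ) + 1)) (2 * R + 3) η (plane G r q x)) ≤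
      torusE G r β L (fun U => plane G r q x U * plane G r q x U) -
        torusE G r β L (plane G r q x) * torusE G r β L (plane G r q x) := by
  obtain ⟨C, hC⟩ := exists_abs_plane_le (G := G) r
  have hT : 2 * R + 3 + 3 ≤ 2 * L + 1 := by omega
  exact torusVar_kerE_le G r β _ _ L hT (continuous_plane r q x) (hC q x) (isCylinder_plane r q x) (supp_plane_window R q x)

/-- **Singleton exponential response moment, antitone in the radius at FIXED rate**: for `λ ≥ 0`, any reference value `p`,
`R + 1 ≤ R'`, `R' + 3 ≤ L`: `E_T[exp(λ|kerE_{R'}(P_q(x)) − p|)] ≤ E_T[exp(λ|kerE_R(P_q(x)) − p|)]`.  ((RM) itself puts the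
`R`-DEPENDENT rate `λ = R⁴/C₁` in the exponent; that growth is its content and is not touched here.) [folklore] -/
theorem torusE_exp_abs_kerE_plane_antitone (β : ℝ) (L : ℕ) {R R' : ℕ} (hRR' : R + 1 ≤ R') (hL : R' + 3 ≤ L)
    (q : Fin 4 × Fin 4) (x : Fin 4 → ℤ) {lam : ℝ} (hlam : 0 ≤ lam) (p : ℝ) :
    torusE G r β L (fun η =>
        Real.exp (lam * |kerE G r β (fun k => x k - ((R' : ℤ) + 1)) (2 * R' + 3) η (plane G r q x) - p|)) ≤
      torusE G r β L (fun η =>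
        Real.exp (lam * |kerE G r β (fun k => x k - ((R : ℤ) + 1)) (2 * R + 3) η (plane G r q x) - p|)) :=
  torusE_convex_kerE_plane_antitone G r β L hRR' hL q x (convexOn_exp_mul_abs_sub hlam p)
    (continuous_exp_mul_abs_sub lam p)

/-- **Singleton exponential response moment ≤ the bare exponential moment**: for `λ ≥ 0`, any `p`, `R + 3 ≤ L`:
`E_T[exp(λ|kerE_R(P_q(x)) − p|)] ≤ E_T[exp(λ|P_q(x) − p|)]`. [folklore] -/
theorem torusE_exp_abs_kerE_plane_le_bare (β : ℝ) (L R : ℕ) (hL : R + 3 ≤ L) (q : Fin 4 × Fin 4) (x : Fin 4 → ℤ)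
    {lam : ℝ} (hlam : 0 ≤ lam) (p : ℝ) :
    torusE G r β L (fun η =>
        Real.exp (lam * |kerE G r β (fun k => x k - ((R : ℤ) + 1)) (2 * R + 3) η (plane G r q x) - p|)) ≤
      torusE G r β L (fun U => Real.exp (lam * |plane G r q x U - p|)) := by
  obtain ⟨C, hC⟩ := exists_abs_plane_le (G := G) r
  have hT : 2 * R + 3 + 3 ≤ 2 * L + 1 := by omega
  exact torusE_convex_kerE_le G r β _ _ L hT (continuous_plane r q x) (hC q x) (isCylinder_plane r q x)
    (supp_plane_window R q x) (convexOn_exp_mul_abs_sub hlam p) (continuous_exp_mul_abs_sub lam p)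

end Letters

end Summit.QuantumFields.YangMills.Cruxes.NT.KernelJensen

end
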